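import Summits.CriticalPhenomena.PercolationContinuityZ3.Theorems.SahiMasterFamilyPointwise
import Summits.CriticalPhenomena.PercolationContinuityZ3.Theorems.SahiMasterFamilyEqPrincipal

/-!
# The settled class is closed under INDEPENDENT INTERSECTION: `(V_i ∩ W_i)` with `V` on `F`, `W` on `Fᶜ` (order three)

Unit `prim-master-conj` (crux anchor stmt-CriticalPhenomena-4575, helper work), gen 14; memo
`run/shared/lean/prim/prim-l12/prim-master-conj/POINTWISE.md` §15.

Call a triple of increasing events `U` SETTLED when Sahi's `C_3` and the pointwise master equality conjecture hold for it at every interior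
parameter: `E_3(μ_p; 1_U) ≥ 0` and `E_3(μ_p; 1_U) = 0 ↔ U ∈ Z_3`.  The tree knows many settled classes (shared-face-vanishing triples, the
residual strata, principal caps, cores `≤ 4`, …) and two closure operations (private extension `…PointwisePrivate`, absorbing extension
`…PointwiseAbsorbing`).  This file adds a third closure operation: **independent member-wise intersection**.
* `ex_ind_inter_of_separated` — `E(1_{A∩B}) = E(1_A)E(1_B)` for `A` determined by `F`, `B` by `Fᶜ` (the tree's product-measure independence);
* `sahiE_three_ind_tensor_eq` — the order-three LAW OF TOTAL CUMULANCE for a separable triple `U_i = V_i ∩ W_i` in closed form: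
  `E_3(U) = E_3(V)·μ(W_0W_1W_2) + Σ_j Cov(V_k,V_l)·μ(V_j)·Cov(W_k∩W_l, W_j) + μ(V_0)μ(V_1)μ(V_2)·E_3(W)`
  (five products of non-negative, TRANSFERABLE factors: each factor is `≥ 0` and its vanishing at one interior point is a measure-free
  condition — `Z_3`, emptiness, disjoint determining sets — hence vanishing at every interior point);
* **`sahiE_three_ind_tensor_nonneg`** — `C_3` for `U` at `p` from `C_3` for `V` and `W` at `p` (P4's tensorisation, order three, events);
* **`sahiE_three_ind_tensor_eq_zero_iff`** — if `V` and `W` are settled then so is `U`: at interior `p`, `E_3(μ_p;1_U) = 0 ↔ U ∈ Z_3`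
  (zero at `p` ⟹ every term zero at `p` ⟹ every term zero at every interior `q` ⟹ `E_3(U) ≡ 0` on the open cube ⟹ `Z_3` by (EQI-3));
  strict form `sahiE_three_ind_tensor_pos`.
So, e.g., the member-wise intersection of a shared-face-vanishing triple on `F` with a principal-cap triple on `Fᶜ` is settled — a family that is
in general neither shared-face-vanishing nor an absorbing/private extension.  HONEST FRAMING: a closure property; `C_3` / Kahn's Conjecture 5
and `MasterFamilyEqIff 3` remain OPEN.  Axioms standard. [this work]
-/

noncomputable section

open scoped Classical

namespace Summit.CriticalPhenomena.PercolationContinuityZ3.Theorems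

open Finset Function
open Literature.Combinatorics.Sahi2008
open Literature.Probability.LatticeModels (prodBernoulli prodBernoulli_real_inter_of_determinedBy_disjoint)
open Literature.Probability.Percolation (DeterminedBy)
open Literature.Probability.Percolation.DecisionTree (ind ind_nonneg)

namespace Pointwise

variable {ι : Type} [Fintype ι]

/-! ### 1. Independence of separated events, in `ex`/`ind` form -/

/-- `E(1_{A∩B}) = E(1_A)·E(1_B)` when `A` is determined by `F` and `B` by `Fᶜ`. [folklore] -/
theorem ex_ind_inter_of_separated (p : ι → unitInterval) (F : Finset ι) {A B : Set (Set ι)} (hA : DeterminedBy A (↑F : Set ι))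
    (hB : DeterminedBy B (↑F : Set ι)ᶜ) :
    ex (bernoulliWeight p) (ind (A ∩ B)) = ex (bernoulliWeight p) (ind A) * ex (bernoulliWeight p) (ind B) := by
  rw [ex_bernoulliWeight_ind, ex_bernoulliWeight_ind, ex_bernoulliWeight_ind]
  have hB' : DeterminedBy B (↑(Fᶜ) : Set ι) := by rwa [Finset.coe_compl]
  exact prodBernoulli_real_inter_of_determinedBy_disjoint p disjoint_compl_right hA hB' MeasurableSet.of_discrete
    MeasurableSet.of_discrete

/-- The same for products of indicators. [folklore] -/
theorem ex_ind_mul_ind_of_separated (p : ι → unitInterval) (F : Finset ι) {A B : Set (Set ι)} (hA : DeterminedBy A (↑F : Set ι))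
    (hB : DeterminedBy B (↑F : Set ι)ᶜ) :
    ex (bernoulliWeight p) (ind A * ind B) = ex (bernoulliWeight p) (ind A) * ex (bernoulliWeight p) (ind B) := by
  rw [ind_mul_ind_eq_inter]; exact ex_ind_inter_of_separated p F hA hB

/-! ### 2. The order-three law of total cumulance in closed form -/

section Identity

variable (p : ι → unitInterval) (F : Finset ι) (V W : Fin 3 → Set (Set ι))

omit [Fintype ι] in
/-- Regrouping `∏ 1_{V_i ∩ W_i}` over two slots. [folklore] -/
theorem ind_inter_mul_two (i j : Fin 3) :
    ind (V i ∩ W i) * ind (V j ∩ W j) = ind (V i ∩ V j) * ind (W i ∩ W j) := by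
  funext ω
  simp only [Pi.mul_apply, ← ind_mul_ind_eq_inter]
  ring

omit [Fintype ι] in
/-- Regrouping `∏ 1_{V_i ∩ W_i}` over the three slots. [folklore] -/
theorem ind_inter_mul_three :
    ind (V 0 ∩ W 0) * ind (V 1 ∩ W 1) * ind (V 2 ∩ W 2) = ind (V 0 ∩ V 1 ∩ V 2) * ind (W 0 ∩ W 1 ∩ W 2) := by
  funext ω
  simp only [Pi.mul_apply, ← ind_mul_ind_eq_inter]
  ring

variable {V W}

/-- **Order-three law of total cumulance, closed form**: for `V_i` determined by `F` and `W_i` by `Fᶜ`,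
`E_3(1_{V∩W}) = E_3(1_V)·E(1_{W_0W_1W_2}) + Σ_j Cov(V_k,V_l)·E(1_{V_j})·Cov(W_kW_l, W_j) + E(1_{V_0})E(1_{V_1})E(1_{V_2})·E_3(1_W)`. [this work] -/
theorem sahiE_three_ind_tensor_eq (hV : ∀ i, DeterminedBy (V i) (↑F : Set ι)) (hW : ∀ i, DeterminedBy (W i) (↑F : Set ι)ᶜ) :
    sahiE (bernoulliWeight p) 3 (fun i => ind (V i ∩ W i)) =
      sahiE (bernoulliWeight p) 3 (fun i => ind (V i)) * ex (bernoulliWeight p) (ind (W 0 ∩ W 1 ∩ W 2)) +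
      ((ex (bernoulliWeight p) (ind (V 1 ∩ V 2)) - ex (bernoulliWeight p) (ind (V 1)) * ex (bernoulliWeight p) (ind (V 2))) *
          ex (bernoulliWeight p) (ind (V 0)) *
          (ex (bernoulliWeight p) (ind (W 1 ∩ W 2 ∩ W 0)) -
            ex (bernoulliWeight p) (ind (W 1 ∩ W 2)) * ex (bernoulliWeight p) (ind (W 0))) +
        (ex (bernoulliWeight p) (ind (V 0 ∩ V 2)) - ex (bernoulliWeight p) (ind (V 0)) * ex (bernoulliWeight p) (ind (V 2))) *
          ex (bernoulliWeight p) (ind (V 1)) *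
          (ex (bernoulliWeight p) (ind (W 0 ∩ W 2 ∩ W 1)) -
            ex (bernoulliWeight p) (ind (W 0 ∩ W 2)) * ex (bernoulliWeight p) (ind (W 1))) +
        (ex (bernoulliWeight p) (ind (V 0 ∩ V 1)) - ex (bernoulliWeight p) (ind (V 0)) * ex (bernoulliWeight p) (ind (V 1))) *
          ex (bernoulliWeight p) (ind (V 2)) *
          (ex (bernoulliWeight p) (ind (W 0 ∩ W 1 ∩ W 2)) -
            ex (bernoulliWeight p) (ind (W 0 ∩ W 1)) * ex (bernoulliWeight p) (ind (W 2)))) +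
      ex (bernoulliWeight p) (ind (V 0)) * ex (bernoulliWeight p) (ind (V 1)) * ex (bernoulliWeight p) (ind (V 2)) *
        sahiE (bernoulliWeight p) 3 (fun i => ind (W i)) := by
  -- determining sets of the intersections
  have hV01 : DeterminedBy (V 0 ∩ V 1) (↑F : Set ι) := (hV 0).inter (hV 1)
  have hV02 : DeterminedBy (V 0 ∩ V 2) (↑F : Set ι) := (hV 0).inter (hV 2)
  have hV12 : DeterminedBy (V 1 ∩ V 2) (↑F : Set ι) := (hV 1).inter (hV 2)
  have hV012 : DeterminedBy (V 0 ∩ V 1 ∩ V 2) (↑F : Set ι) := hV01.inter (hV 2)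
  have hW01 : DeterminedBy (W 0 ∩ W 1) (↑F : Set ι)ᶜ := (hW 0).inter (hW 1)
  have hW02 : DeterminedBy (W 0 ∩ W 2) (↑F : Set ι)ᶜ := (hW 0).inter (hW 2)
  have hW12 : DeterminedBy (W 1 ∩ W 2) (↑F : Set ι)ᶜ := (hW 1).inter (hW 2)
  have hW012 : DeterminedBy (W 0 ∩ W 1 ∩ W 2) (↑F : Set ι)ᶜ := hW01.inter (hW 2)
  -- the three `E_3`'s in moments
  rw [sahiE_three_apply, sahiE_three_apply, sahiE_three_apply]
  -- products of indicators as indicators of intersections, then factorise every moment of `U`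
  rw [ind_inter_mul_three, ind_inter_mul_two V W 1 2, ind_inter_mul_two V W 0 2, ind_inter_mul_two V W 0 1,
    ex_ind_mul_ind_of_separated p F hV012 hW012, ex_ind_mul_ind_of_separated p F hV12 hW12,
    ex_ind_mul_ind_of_separated p F hV02 hW02, ex_ind_mul_ind_of_separated p F hV01 hW01,
    ex_ind_inter_of_separated p F (hV 0) (hW 0), ex_ind_inter_of_separated p F (hV 1) (hW 1),
    ex_ind_inter_of_separated p F (hV 2) (hW 2),
    ind_mul_ind_eq_inter, ind_mul_ind_eq_inter, ind_mul_ind_eq_inter, ind_mul_ind_eq_inter,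
    ind_mul_ind_eq_inter, ind_mul_ind_eq_inter, ind_mul_ind_eq_inter, ind_mul_ind_eq_inter]
  have e1 : W 1 ∩ W 2 ∩ W 0 = W 0 ∩ W 1 ∩ W 2 := by ext ω; simp only [Set.mem_inter_iff]; tauto
  have e2 : W 0 ∩ W 2 ∩ W 1 = W 0 ∩ W 1 ∩ W 2 := by ext ω; simp only [Set.mem_inter_iff]; tauto
  rw [e1, e2]
  ring

end Identity

/-! ### 3. Positivity and the transfer of zeros through the five terms -/

section Closure

variable {V W : Fin 3 → Set (Set ι)}

/-- A covariance of increasing events is `≥ 0` (Harris) — the `Cov(W_k∩W_l, W_j)` factors. [cite: Harris1960, Lemma 4.1] -/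
theorem cov_ind_nonneg (p : ι → unitInterval) {A B : Set (Set ι)} (hA : IsUpperSet A) (hB : IsUpperSet B) :
    0 ≤ ex (bernoulliWeight p) (ind (A ∩ B)) - ex (bernoulliWeight p) (ind A) * ex (bernoulliWeight p) (ind B) :=
  sub_nonneg.2 (harris_ex_ind p hA hB)

/-- **Strict Harris, transfer form**: a covariance of increasing events vanishing at ONE interior point vanishes at every point. [this work] -/
theorem cov_ind_eq_zero_transfer {p : ι → unitInterval} (hp : ∀ e, (p e : ℝ) ∈ Set.Ioo (0 : ℝ) 1) (q : ι → unitInterval)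
    {A B : Set (Set ι)} (hA : IsUpperSet A) (hB : IsUpperSet B)
    (h : ex (bernoulliWeight p) (ind (A ∩ B)) - ex (bernoulliWeight p) (ind A) * ex (bernoulliWeight p) (ind B) = 0) :
    ex (bernoulliWeight q) (ind (A ∩ B)) - ex (bernoulliWeight q) (ind A) * ex (bernoulliWeight q) (ind B) = 0 := by
  have h' : ex (bernoulliWeight p) (ind A * ind B) = ex (bernoulliWeight p) (ind A) * ex (bernoulliWeight p) (ind B) := by
    rw [ind_mul_ind_eq_inter]; linarith
  obtain ⟨S, T, hST, hS, hT⟩ := disjoint_determinedBy_of_real_inter_eq p hp hA hB h'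
  rw [ex_bernoulliWeight_ind, ex_bernoulliWeight_ind, ex_bernoulliWeight_ind,
    prodBernoulli_real_inter_of_determinedBy_disjoint q hST hS hT MeasurableSet.of_discrete MeasurableSet.of_discrete, sub_self]

/-- `E(1_A) = 0` is measure-free in the open cube: it transfers between interior points (indeed `A = ∅`). [this work] -/
theorem ex_ind_eq_zero_transfer {p : ι → unitInterval} (hp : ∀ e, (p e : ℝ) ∈ Set.Ioo (0 : ℝ) 1) (q : ι → unitInterval)
    (A : Set (Set ι)) (h : ex (bernoulliWeight p) (ind A) = 0) : ex (bernoulliWeight q) (ind A) = 0 := by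
  have hA : A = ∅ := by
    by_contra hne
    obtain ⟨ω, hω⟩ := Set.nonempty_iff_ne_empty.2 hne
    have hpos : 0 < ex (bernoulliWeight p) (ind A) := by
      unfold ex
      refine lt_of_lt_of_le ?_ (Finset.single_le_sum (f := fun x => bernoulliWeight p x * ind A x)
        (fun x _ => mul_nonneg ((isFKGMeasure_bernoulliWeight p).nonneg x) (ind_nonneg A x)) (Finset.mem_univ ω))
      rw [Literature.Probability.Percolation.DecisionTree.ind_of_mem hω, mul_one]
      exact bernoulliWeight_pos hp ω
    linarith
  subst hA
  unfold ex
  exact Finset.sum_eq_zero fun x _ => by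
    rw [Literature.Probability.Percolation.DecisionTree.ind_of_not_mem (Set.notMem_empty x), mul_zero]

/-- **`C_3` tensorises (order three, events)**: `C_3` at `p` for `V` (on `F`) and `W` (on `Fᶜ`) gives `C_3` at `p` for `(V_i ∩ W_i)`.
[this work] -/
theorem sahiE_three_ind_tensor_nonneg (p : ι → unitInterval) (F : Finset ι) (hV : ∀ i, DeterminedBy (V i) (↑F : Set ι))
    (hW : ∀ i, DeterminedBy (W i) (↑F : Set ι)ᶜ) (hVu : ∀ i, IsUpperSet (V i)) (hWu : ∀ i, IsUpperSet (W i))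
    (hVp : 0 ≤ sahiE (bernoulliWeight p) 3 (fun i => ind (V i))) (hWp : 0 ≤ sahiE (bernoulliWeight p) 3 (fun i => ind (W i))) :
    0 ≤ sahiE (bernoulliWeight p) 3 (fun i => ind (V i ∩ W i)) := by
  rw [sahiE_three_ind_tensor_eq p F hV hW]
  have m0 : ∀ A : Set (Set ι), 0 ≤ ex (bernoulliWeight p) (ind A) := fun A => ex_nonneg (fun ω => (isFKGMeasure_bernoulliWeight p).nonneg ω) (ind_nonneg A)
  refine add_nonneg (add_nonneg (mul_nonneg hVp (m0 _)) (add_nonneg (add_nonneg ?_ ?_) ?_))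
    (mul_nonneg (mul_nonneg (mul_nonneg (m0 _) (m0 _)) (m0 _)) hWp)
  · exact mul_nonneg (mul_nonneg (cov_ind_nonneg p (hVu 1) (hVu 2)) (m0 _)) (cov_ind_nonneg p ((hWu 1).inter (hWu 2)) (hWu 0))
  · exact mul_nonneg (mul_nonneg (cov_ind_nonneg p (hVu 0) (hVu 2)) (m0 _)) (cov_ind_nonneg p ((hWu 0).inter (hWu 2)) (hWu 1))
  · exact mul_nonneg (mul_nonneg (cov_ind_nonneg p (hVu 0) (hVu 1)) (m0 _)) (cov_ind_nonneg p ((hWu 0).inter (hWu 1)) (hWu 2))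

/-- **Zero transfer for separable triples**: if `V` and `W` are SETTLED on the open cube (non-negative, zero exactly on `Z_3`), then a zero of
`E_3(μ_p; 1_{V∩W})` at one interior `p` forces a zero at every interior `q`. [this work] -/
theorem sahiE_three_ind_tensor_eq_zero_transfer {p : ι → unitInterval} (hp : ∀ e, (p e : ℝ) ∈ Set.Ioo (0 : ℝ) 1)
    (q : ι → unitInterval) (F : Finset ι)
    (hV : ∀ i, DeterminedBy (V i) (↑F : Set ι)) (hW : ∀ i, DeterminedBy (W i) (↑F : Set ι)ᶜ)
    (hVu : ∀ i, IsUpperSet (V i)) (hWu : ∀ i, IsUpperSet (W i))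
    (hVs : ∀ r : ι → unitInterval, (∀ e, (r e : ℝ) ∈ Set.Ioo (0 : ℝ) 1) →
      0 ≤ sahiE (bernoulliWeight r) 3 (fun i => ind (V i)) ∧ (sahiE (bernoulliWeight r) 3 (fun i => ind (V i)) = 0 ↔ SuppZeroFlag 3 V))
    (hWs : ∀ r : ι → unitInterval, (∀ e, (r e : ℝ) ∈ Set.Ioo (0 : ℝ) 1) →
      0 ≤ sahiE (bernoulliWeight r) 3 (fun i => ind (W i)) ∧ (sahiE (bernoulliWeight r) 3 (fun i => ind (W i)) = 0 ↔ SuppZeroFlag 3 W))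
    (hz : sahiE (bernoulliWeight p) 3 (fun i => ind (V i ∩ W i)) = 0) :
    sahiE (bernoulliWeight q) 3 (fun i => ind (V i ∩ W i)) = 0 := by
  have mp : ∀ A : Set (Set ι), 0 ≤ ex (bernoulliWeight p) (ind A) := fun A => ex_nonneg (fun ω => (isFKGMeasure_bernoulliWeight p).nonneg ω) (ind_nonneg A)
  obtain ⟨hVp, hVz⟩ := hVs p hp
  obtain ⟨hWp, hWz⟩ := hWs p hp
  -- the five non-negative terms at `p`
  have c12 := cov_ind_nonneg p (hVu 1) (hVu 2)
  have c02 := cov_ind_nonneg p (hVu 0) (hVu 2)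
  have c01 := cov_ind_nonneg p (hVu 0) (hVu 1)
  have d0 := cov_ind_nonneg p ((hWu 1).inter (hWu 2)) (hWu 0)
  have d1 := cov_ind_nonneg p ((hWu 0).inter (hWu 2)) (hWu 1)
  have d2 := cov_ind_nonneg p ((hWu 0).inter (hWu 1)) (hWu 2)
  have t1 := mul_nonneg hVp (mp (W 0 ∩ W 1 ∩ W 2))
  have t2 := mul_nonneg (mul_nonneg c12 (mp (V 0))) d0
  have t3 := mul_nonneg (mul_nonneg c02 (mp (V 1))) d1
  have t4 := mul_nonneg (mul_nonneg c01 (mp (V 2))) d2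
  have t5 := mul_nonneg (mul_nonneg (mul_nonneg (mp (V 0)) (mp (V 1))) (mp (V 2))) hWp
  rw [sahiE_three_ind_tensor_eq p F hV hW] at hz
  have z1 : sahiE (bernoulliWeight p) 3 (fun i => ind (V i)) * ex (bernoulliWeight p) (ind (W 0 ∩ W 1 ∩ W 2)) = 0 := by linarith
  have z2 : (ex (bernoulliWeight p) (ind (V 1 ∩ V 2)) - ex (bernoulliWeight p) (ind (V 1)) * ex (bernoulliWeight p) (ind (V 2))) *
      ex (bernoulliWeight p) (ind (V 0)) *
      (ex (bernoulliWeight p) (ind (W 1 ∩ W 2 ∩ W 0)) - ex (bernoulliWeight p) (ind (W 1 ∩ W 2)) * ex (bernoulliWeight p) (ind (W 0))) = 0 := by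
    linarith
  have z3 : (ex (bernoulliWeight p) (ind (V 0 ∩ V 2)) - ex (bernoulliWeight p) (ind (V 0)) * ex (bernoulliWeight p) (ind (V 2))) *
      ex (bernoulliWeight p) (ind (V 1)) *
      (ex (bernoulliWeight p) (ind (W 0 ∩ W 2 ∩ W 1)) - ex (bernoulliWeight p) (ind (W 0 ∩ W 2)) * ex (bernoulliWeight p) (ind (W 1))) = 0 := by
    linarith
  have z4 : (ex (bernoulliWeight p) (ind (V 0 ∩ V 1)) - ex (bernoulliWeight p) (ind (V 0)) * ex (bernoulliWeight p) (ind (V 1))) *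
      ex (bernoulliWeight p) (ind (V 2)) *
      (ex (bernoulliWeight p) (ind (W 0 ∩ W 1 ∩ W 2)) - ex (bernoulliWeight p) (ind (W 0 ∩ W 1)) * ex (bernoulliWeight p) (ind (W 2))) = 0 := by
    linarith
  have z5 : ex (bernoulliWeight p) (ind (V 0)) * ex (bernoulliWeight p) (ind (V 1)) * ex (bernoulliWeight p) (ind (V 2)) *
      sahiE (bernoulliWeight p) 3 (fun i => ind (W i)) = 0 := by linarith
  -- transfer each term to `q`
  have T1 : sahiE (bernoulliWeight q) 3 (fun i => ind (V i)) * ex (bernoulliWeight q) (ind (W 0 ∩ W 1 ∩ W 2)) = 0 := by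
    rcases mul_eq_zero.1 z1 with h | h
    · rw [masterFamilyEqIff_mpr 3 ι q V (hVz.1 h), zero_mul]
    · rw [ex_ind_eq_zero_transfer hp q _ h, mul_zero]
  have Tcov : ∀ (j k l : Fin 3),
      (ex (bernoulliWeight p) (ind (V k ∩ V l)) - ex (bernoulliWeight p) (ind (V k)) * ex (bernoulliWeight p) (ind (V l))) *
          ex (bernoulliWeight p) (ind (V j)) *
          (ex (bernoulliWeight p) (ind (W k ∩ W l ∩ W j)) -
            ex (bernoulliWeight p) (ind (W k ∩ W l)) * ex (bernoulliWeight p) (ind (W j))) = 0 →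
      (ex (bernoulliWeight q) (ind (V k ∩ V l)) - ex (bernoulliWeight q) (ind (V k)) * ex (bernoulliWeight q) (ind (V l))) *
          ex (bernoulliWeight q) (ind (V j)) *
          (ex (bernoulliWeight q) (ind (W k ∩ W l ∩ W j)) -
            ex (bernoulliWeight q) (ind (W k ∩ W l)) * ex (bernoulliWeight q) (ind (W j))) = 0 := by
    intro j k l h
    rcases mul_eq_zero.1 h with h | h
    · rcases mul_eq_zero.1 h with h | h
      · rw [cov_ind_eq_zero_transfer hp q (hVu k) (hVu l) h, zero_mul, zero_mul]
      · rw [ex_ind_eq_zero_transfer hp q _ h, mul_zero, zero_mul]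
    · rw [cov_ind_eq_zero_transfer hp q ((hWu k).inter (hWu l)) (hWu j) h, mul_zero]
  have T5 : ex (bernoulliWeight q) (ind (V 0)) * ex (bernoulliWeight q) (ind (V 1)) * ex (bernoulliWeight q) (ind (V 2)) *
      sahiE (bernoulliWeight q) 3 (fun i => ind (W i)) = 0 := by
    rcases mul_eq_zero.1 z5 with h | h
    · rcases mul_eq_zero.1 h with h | h
      · rcases mul_eq_zero.1 h with h | h
        · rw [ex_ind_eq_zero_transfer hp q _ h]; ring
        · rw [ex_ind_eq_zero_transfer hp q _ h]; ring
      · rw [ex_ind_eq_zero_transfer hp q _ h]; ring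
    · rw [masterFamilyEqIff_mpr 3 ι q W (hWz.1 h), mul_zero]
  rw [sahiE_three_ind_tensor_eq q F hV hW, T1, Tcov 0 1 2 z2, Tcov 1 0 2 z3, Tcov 2 0 1 z4, T5]
  ring

/-- **The settled class is closed under independent intersection (order three)**: if `V` (determined by `F`) and `W` (determined by `Fᶜ`) each
satisfy `C_3` and the pointwise master equality statement at every interior parameter, then so does `U_i = V_i ∩ W_i`: for `p` in the open cube,
`E_3(μ_p; 1_U) ≥ 0` and `E_3(μ_p; 1_U) = 0 ↔ U ∈ Z_3`. [this work] -/
theorem sahiE_three_ind_tensor_eq_zero_iff {p : ι → unitInterval} (hp : ∀ e, (p e : ℝ) ∈ Set.Ioo (0 : ℝ) 1) (F : Finset ι)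
    (hV : ∀ i, DeterminedBy (V i) (↑F : Set ι)) (hW : ∀ i, DeterminedBy (W i) (↑F : Set ι)ᶜ)
    (hVu : ∀ i, IsUpperSet (V i)) (hWu : ∀ i, IsUpperSet (W i))
    (hVs : ∀ r : ι → unitInterval, (∀ e, (r e : ℝ) ∈ Set.Ioo (0 : ℝ) 1) →
      0 ≤ sahiE (bernoulliWeight r) 3 (fun i => ind (V i)) ∧ (sahiE (bernoulliWeight r) 3 (fun i => ind (V i)) = 0 ↔ SuppZeroFlag 3 V))
    (hWs : ∀ r : ι → unitInterval, (∀ e, (r e : ℝ) ∈ Set.Ioo (0 : ℝ) 1) →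
      0 ≤ sahiE (bernoulliWeight r) 3 (fun i => ind (W i)) ∧ (sahiE (bernoulliWeight r) 3 (fun i => ind (W i)) = 0 ↔ SuppZeroFlag 3 W)) :
    0 ≤ sahiE (bernoulliWeight p) 3 (fun i => ind (V i ∩ W i)) ∧
      (sahiE (bernoulliWeight p) 3 (fun i => ind (V i ∩ W i)) = 0 ↔ SuppZeroFlag 3 (fun i => V i ∩ W i)) := by
  refine ⟨sahiE_three_ind_tensor_nonneg p F hV hW hVu hWu (hVs p hp).1 (hWs p hp).1, fun hz => ?_,
    fun hZ => masterFamilyEqIff_mpr 3 ι p _ hZ⟩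
  refine suppZeroFlag_of_eq_zero_on_paramBox (fun i => V i ∩ W i) (fun i => (hVu i).inter (hWu i)) (a := fun _ => 0) (b := fun _ => 1)
    (fun _ => zero_lt_one) (fun _ => le_rfl) (fun _ => le_rfl) fun q hq => ?_
  exact sahiE_three_ind_tensor_eq_zero_transfer hp q F hV hW hVu hWu hVs hWs hz

/-- **Strict form**: under the same hypotheses, `U = (V_i ∩ W_i) ∉ Z_3` has `E_3(μ_p; 1_U) > 0` at every interior `p`. [this work] -/
theorem sahiE_three_ind_tensor_pos {p : ι → unitInterval} (hp : ∀ e, (p e : ℝ) ∈ Set.Ioo (0 : ℝ) 1) (F : Finset ι)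
    (hV : ∀ i, DeterminedBy (V i) (↑F : Set ι)) (hW : ∀ i, DeterminedBy (W i) (↑F : Set ι)ᶜ)
    (hVu : ∀ i, IsUpperSet (V i)) (hWu : ∀ i, IsUpperSet (W i))
    (hVs : ∀ r : ι → unitInterval, (∀ e, (r e : ℝ) ∈ Set.Ioo (0 : ℝ) 1) →
      0 ≤ sahiE (bernoulliWeight r) 3 (fun i => ind (V i)) ∧ (sahiE (bernoulliWeight r) 3 (fun i => ind (V i)) = 0 ↔ SuppZeroFlag 3 V))
    (hWs : ∀ r : ι → unitInterval, (∀ e, (r e : ℝ) ∈ Set.Ioo (0 : ℝ) 1) →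
      0 ≤ sahiE (bernoulliWeight r) 3 (fun i => ind (W i)) ∧ (sahiE (bernoulliWeight r) 3 (fun i => ind (W i)) = 0 ↔ SuppZeroFlag 3 W))
    (hZ : ¬ SuppZeroFlag 3 (fun i => V i ∩ W i)) : 0 < sahiE (bernoulliWeight p) 3 (fun i => ind (V i ∩ W i)) := by
  obtain ⟨h0, hiff⟩ := sahiE_three_ind_tensor_eq_zero_iff hp F hV hW hVu hWu hVs hWs
  exact lt_of_le_of_ne h0 fun h => hZ (hiff.1 h.symm)

end Closure

end Pointwise

end Summit.CriticalPhenomena.PercolationContinuityZ3.Theorems
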